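import Summits.Ventures.CertifiedManyBodySolver.Observables.RungLeavesStiffnessAnchor
import HarnessLib

/-!
# Ventures/CertifiedManyBodySolver — Observables/StiffnessTPrimeSegmentLeaf.lean

HONEST FRAMING: one-sided certified CEILINGS on the uniform flux stiffness along a `t'`-SEGMENT of a material box at fixed
`(U, n)`; a ceiling never speaks to the presence of order; not a `T_c` estimate, not a superconductivity verdict; every leaf
below is CONDITIONAL on the (unconditional-shape) row family it names — typically the conclusion of a REGION-VALID DUAL, i.e. two
corner certificates at `t'₁, t'₂` sharing `κ`, the Gram basis and the eom family, combined at every point of the segment by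
`Literature/…/HubbardTTPrimeWindowCertificateConvexCombObjective` (`…_convexCombObj_TT'_ineq_affine`).

Cell `pub/hubbard-downfold` (MO-S1 ↔ S2 seam; D-0150 L-DF2 «box ↦ one word»), seat hubbard-downfold-unc-2 standing in for the
unseated `t'`-direction seat (`prover-hubbard-downfold-unc-2-g12-0`); written for hubbard-obs RULING (xx) d294 / (zz) d296 L4
«MOTT-BOX» (`[29/5, 74/5] × [−3/10, −1/5]` at `n = 1`), fork (ii-b): «one dual vector certified feasible at BOTH `t'` endpoints of a
`U₀`-edge is feasible on the whole segment ⇒ bound affine in `t'` ⇒ `c_box = max` of the two corner words». The one structural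
fact the f-sum route needs is §1: at `λ = 0` the `t–t'` stiffness word `X₀(t') = oddMomentObsTT t' U 0 = ½ k₀^{tt'}` is AFFINE in
`t'` and independent of `U` — so it is an «affine objective family» in the sense of the Literature theorem, and the combined
corner certificates bound EXACTLY the word the leaf `ObsStiffnessSeqCeilingAt t' U n c` consumes at each `t'`.

* §1 `oddMomentObsTT_lamZero_affine` — `X₀(t', U) = X₀(0, 0) + t' • (X₀(1, 0) − X₀(0, 0))`; `negOddMomentObsTT_lamZero_eq_affine` —
  the negated word in the `X₀ + t' • X₁ + U • X₂` shape of `…_convexCombObj_TT'_ineq_affine` (`X₂ = 0`);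
* §2 `tPrimeSegment_weights`, `min_le_chord_of_weights` — barycentric weights of a point of `[t'₁, t'₂]` (nonnegative, sum `1`,
  reproduce `t'` and the shared `U`); the chord of two corner constants is at least the smaller one;
* §4 `ObsStiffnessSeqCeilingAt_on_tPrimeURect_of_forall_orbitLower`, `tPrimeURect_weights`, `min_le_convexComb_four` — the
  `(t', U)` RECTANGLE from FOUR corner certificates (the `λ = 0` word is `U`-free, so no `U`-ray is needed);
* §3 `ObsStiffnessSeqCeilingAt_on_tPrimeSegment_of_forall_orbitLower` — a family of UNCONDITIONAL orbit-lower statements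
  `val t' ≤ |S|⁻¹ Σ_γ Re ω_γ(−X_λ(t'))` on the torus-limit ground-state classes at `(t', U, n)`, `t' ∈ [t'₁, t'₂]` (the shape a
  combined certificate has once its energy cap is discharged on the segment), with `−val t' ≤ c` on the segment, gives
  `ObsStiffnessSeqCeilingAt t' U n c` for EVERY `t'` of the segment; `…_of_chord` — the two-corner form: `val` = the chord of the
  corner constants `v₁, v₂` ⇒ `c ≥ max(−v₁, −v₂)` suffices («the `t'`-interior is covered by its two corners»).

Not here: the `U` direction at `t' ≠ 0` (the f-sum word carries the diagonal term; hubbard-obs p2's ray edition), numbers.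

References: D. J. Scalapino, S. R. White, S.-C. Zhang, PRB 47 (1993) 7995, §II [ScalapinoWhiteZhang1993]; J. Wang et al.,
PRX 14 (2024) 031006, §III [WangEtAl2024]; E. Lipparini, Modern Many-Particle Physics (2008), eq. (8.30) [Lipparini2008].
-/

noncomputable section

namespace Summit.Ventures.CertifiedManyBodySolver.Observables

open Matrix Finset Filter Topology
open Literature.MathematicalPhysics.QuantumLattice
open Literature.MathematicalPhysics.QuantumLattice.ThermodynamicLimit
open Literature.Probability.LatticeModels
open scoped ComplexOrder ComplexConjugate Topology BigOperators

/-! ## §1 At `λ = 0` the `t–t'` stiffness word is affine in `t'` and free of `U` -/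

/-- **`X₀(t', U) = X₀(0, 0) + t' • (X₀(1, 0) − X₀(0, 0))`**: at `λ = 0` the odd-moment word reduces to `½ k₀^{tt'}`, whose NNN bond
terms carry the factor `t'` (`kinBondObsTT`), and the `U`-dependent moments drop out. [cite: Lipparini2008, eq. (8.30)] -/
theorem oddMomentObsTT_lamZero_affine (tp U : ℝ) :
    oddMomentObsTT tp U 0 = oddMomentObsTT 0 0 0 + ((tp : ℝ) : ℂ) • (oddMomentObsTT 1 0 0 - oddMomentObsTT 0 0 0) := by
  unfold oddMomentObsTT kinBondObsTT
  simp only [map_add, map_smul, Complex.ofReal_zero, Complex.ofReal_one, zero_smul, one_smul, add_zero,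
    sub_zero, zero_pow two_ne_zero, zero_div]
  module

/-- The NEGATED `λ = 0` word in the «affine objective family» shape `X₀ + t' • X₁ + U • X₂` of
`IsTorusLimitOf.re_sum_expect_d4_ge_of_window_certificates_convexCombObj_TT'_ineq_affine` (with `X₂ = 0`). [cite: Lipparini2008, eq. (8.30)] -/
theorem negOddMomentObsTT_lamZero_eq_affine (tp U : ℝ) :
    -oddMomentObsTT tp U 0 =
      -oddMomentObsTT 0 0 0 + ((tp : ℝ) : ℂ) • (-(oddMomentObsTT 1 0 0 - oddMomentObsTT 0 0 0)) +
        ((U : ℝ) : ℂ) • (0 : FermionOp (box 2 7)) := by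
  rw [oddMomentObsTT_lamZero_affine tp U, smul_zero, add_zero, smul_neg, neg_add]

/-! ## §2 Barycentric weights of a point of a `t'`-segment -/

/-- **Barycentric weights of a point of a segment.** For `t'₁ < t'₂` and `t' ∈ [t'₁, t'₂]` the weights
`λ₁ = (t'₂ − t')/(t'₂ − t'₁)`, `λ₂ = (t' − t'₁)/(t'₂ − t'₁)` are nonnegative, sum to `1`, reproduce `t' = λ₁ t'₁ + λ₂ t'₂` and any
shared coordinate `λ₁ U + λ₂ U = U` — the data that feed two corner certificates into `…_convexCombObj_TT'_ineq[_affine]`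
with a two-element index set. [folklore] -/
theorem tPrimeSegment_weights {t₁ t₂ tp : ℝ} (h12 : t₁ < t₂) (h1 : t₁ ≤ tp) (h2 : tp ≤ t₂) :
    0 ≤ (t₂ - tp) / (t₂ - t₁) ∧ 0 ≤ (tp - t₁) / (t₂ - t₁) ∧
      (t₂ - tp) / (t₂ - t₁) + (tp - t₁) / (t₂ - t₁) = 1 ∧
      (t₂ - tp) / (t₂ - t₁) * t₁ + (tp - t₁) / (t₂ - t₁) * t₂ = tp ∧
      ∀ U : ℝ, (t₂ - tp) / (t₂ - t₁) * U + (tp - t₁) / (t₂ - t₁) * U = U := by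
  have hd : 0 < t₂ - t₁ := sub_pos.2 h12
  have hsum : (t₂ - tp) / (t₂ - t₁) + (tp - t₁) / (t₂ - t₁) = 1 := by
    rw [← add_div, div_eq_one_iff_eq hd.ne']; ring
  refine ⟨div_nonneg (sub_nonneg.2 h2) hd.le, div_nonneg (sub_nonneg.2 h1) hd.le, hsum, ?_, fun U => ?_⟩
  · field_simp
    ring
  · rw [← add_mul, hsum, one_mul]

/-- The chord of two constants at barycentric weights is at least the smaller constant. [folklore] -/
theorem min_le_chord_of_weights {l₁ l₂ c₁ c₂ : ℝ} (h₁ : 0 ≤ l₁) (h₂ : 0 ≤ l₂) (hs : l₁ + l₂ = 1) :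
    min c₁ c₂ ≤ l₁ * c₁ + l₂ * c₂ := by
  rcases le_total c₁ c₂ with h | h
  · rw [min_eq_left h]
    have h1 : c₁ = (l₁ + l₂) * c₁ := by rw [hs, one_mul]
    nlinarith [mul_le_mul_of_nonneg_left h h₂]
  · rw [min_eq_right h]
    have h1 : c₂ = (l₁ + l₂) * c₂ := by rw [hs, one_mul]
    nlinarith [mul_le_mul_of_nonneg_left h h₁]

/-! ## §3 The stiffness leaf on a `t'`-segment from an unconditional orbit-lower family -/

section Segment

variable {U n : ℝ} {t₁ t₂ : ℝ} {S : Finset (DihedralGroup 4)}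

/-- **Odd-moment / `t–t'` f-sum leaf on a `t'`-SEGMENT.** `S ⊆ D₄` nonempty, `0 ≤ n ≤ 2`; for every `t' ∈ [t'₁, t'₂]` and every
torus limit `ω` of unit `(rectN n L, S^z = 0)`-sector ground states of `hubbardTorusTT' L 1 t' U`, the orbit-lower statement
`val t' ≤ |S|⁻¹ Σ_{γ∈S} Re ω_{γΛ₇}(Γ(d4Emb γ 0) (−X_λ(t')))` (energy cap already discharged), and `−val t' ≤ c` on the segment: then
`ObsStiffnessSeqCeilingAt t' U n c` for every `t'` of the segment. [cite: ScalapinoWhiteZhang1993, §II] -/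
theorem ObsStiffnessSeqCeilingAt_on_tPrimeSegment_of_forall_orbitLower (lam : ℝ) (hS : S.Nonempty) (hn0 : 0 ≤ n)
    (hn2 : n ≤ 2) (val : ℝ → ℝ) (c : ℚ)
    (h : ∀ tp ∈ Set.Icc t₁ t₂, ∀ (ω : InfVolFermionState 2) (Ls : ℕ → ℕ) (ψ : ∀ L, Fock (Orb (FermionTorus 2 L))),
      Tendsto Ls atTop atTop →
      (∀ j, IsGroundStateInSector (hubbardTorusTT' (Ls j) 1 tp U) (rectN n (Ls j)) 0 (ψ (Ls j))) →
      (∀ j, star (ψ (Ls j)) ⬝ᵥ ψ (Ls j) = 1) → ω.IsTorusLimitOf ψ Ls →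
      val tp ≤ (S.card : ℝ)⁻¹ * ∑ g ∈ S,
        (ω.expect (d4ShiftSet g 0 (box 2 7)) (fermionEmbed (PolySite.d4Emb g 0 (box 2 7)) (-oddMomentObsTT tp U lam))).re)
    (hc : ∀ tp ∈ Set.Icc t₁ t₂, -val tp ≤ ((c : ℚ) : ℝ)) :
    ∀ tp ∈ Set.Icc t₁ t₂, ObsStiffnessSeqCeilingAt tp U n c := by
  intro tp htp
  obtain ⟨u, hu⟩ := exists_rat_gt (energyDensityTT' 1 tp U n)
  have hrow : SquareTTPrimeCorrOrbitLowerRow tp U n u (-c) S (box 2 7) (-oddMomentObsTT tp U lam) := by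
    intro ω Ls ψ hLs hψ hψ1 hω _
    have hh := h tp htp ω Ls ψ hLs hψ hψ1 hω
    have hc' := hc tp htp
    push_cast
    linarith
  exact ObsStiffnessSeqCeilingAt_of_oddMomentTT_orbitLowerRow tp U n lam S hS hn0 hn2 hrow hu.le c (by simp)

/-- **Two-corner form («the `t'`-interior is covered by its two corners»).** If the orbit-lower family holds with the CHORD value
`val t' = λ₁(t')·v₁ + λ₂(t')·v₂` of two corner constants (`λᵢ` the barycentric weights of `t'` in `[t'₁, t'₂]`, `t'₁ < t'₂` — the
constant of two corner certificates combined by `…_convexCombObj_TT'_ineq_affine`, residual and density terms included in `vᵢ`), then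
`ObsStiffnessSeqCeilingAt t' U n c` on the whole segment for every `c ≥ max(−v₁, −v₂)`. [cite: WangEtAl2024, §III] -/
theorem ObsStiffnessSeqCeilingAt_on_tPrimeSegment_of_chord (lam : ℝ) (hS : S.Nonempty) (hn0 : 0 ≤ n) (hn2 : n ≤ 2)
    (h12 : t₁ < t₂) (v₁ v₂ : ℝ) (c : ℚ) (hc₁ : -v₁ ≤ ((c : ℚ) : ℝ)) (hc₂ : -v₂ ≤ ((c : ℚ) : ℝ))
    (h : ∀ tp ∈ Set.Icc t₁ t₂, ∀ (ω : InfVolFermionState 2) (Ls : ℕ → ℕ) (ψ : ∀ L, Fock (Orb (FermionTorus 2 L))),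
      Tendsto Ls atTop atTop →
      (∀ j, IsGroundStateInSector (hubbardTorusTT' (Ls j) 1 tp U) (rectN n (Ls j)) 0 (ψ (Ls j))) →
      (∀ j, star (ψ (Ls j)) ⬝ᵥ ψ (Ls j) = 1) → ω.IsTorusLimitOf ψ Ls →
      (t₂ - tp) / (t₂ - t₁) * v₁ + (tp - t₁) / (t₂ - t₁) * v₂ ≤ (S.card : ℝ)⁻¹ * ∑ g ∈ S,
        (ω.expect (d4ShiftSet g 0 (box 2 7)) (fermionEmbed (PolySite.d4Emb g 0 (box 2 7)) (-oddMomentObsTT tp U lam))).re) :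
    ∀ tp ∈ Set.Icc t₁ t₂, ObsStiffnessSeqCeilingAt tp U n c := by
  refine ObsStiffnessSeqCeilingAt_on_tPrimeSegment_of_forall_orbitLower lam hS hn0 hn2
    (fun tp => (t₂ - tp) / (t₂ - t₁) * v₁ + (tp - t₁) / (t₂ - t₁) * v₂) c h fun tp htp => ?_
  obtain ⟨hl₁, hl₂, hsum, -, -⟩ := tPrimeSegment_weights h12 htp.1 htp.2
  have hmin := min_le_chord_of_weights (c₁ := v₁) (c₂ := v₂) hl₁ hl₂ hsum
  have hneg : -min v₁ v₂ ≤ ((c : ℚ) : ℝ) := by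
    rcases le_total v₁ v₂ with hv | hv
    · rw [min_eq_left hv]; exact hc₁
    · rw [min_eq_right hv]; exact hc₂
  linarith

end Segment

/-! ## §4 The `(t', U)` RECTANGLE from four corners (the f-sum word is `U`-free at `λ = 0`) -/

section Rectangle

variable {n : ℝ} {t₁ t₂ U₁ U₂ : ℝ} {S : Finset (DihedralGroup 4)}

/-- **Odd-moment / `t–t'` f-sum leaf on a `(t', U)` RECTANGLE** `[t'₁, t'₂] × [U₁, U₂]` at fixed density `n`: a family of
unconditional orbit-lower statements `val t' U ≤ |S|⁻¹ Σ_γ Re ω_γ(−X_λ(t', U))` on the torus-limit ground-state classes at every point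
of the rectangle (energy cap discharged), with `−val t' U ≤ c` there, gives `ObsStiffnessSeqCeilingAt t' U n c` at EVERY point of the
rectangle. With `λ = 0` the word is affine in `t'` and free of `U` (`negOddMomentObsTT_lamZero_eq_affine`), so FOUR corner
certificates with one region-valid dual, combined by `…_convexCombObj_TT'_ineq_affine` with the bilinear weights below, supply
exactly this family — no `U`-ray is needed. [cite: ScalapinoWhiteZhang1993, §II] -/
theorem ObsStiffnessSeqCeilingAt_on_tPrimeURect_of_forall_orbitLower (lam : ℝ) (hS : S.Nonempty) (hn0 : 0 ≤ n)
    (hn2 : n ≤ 2) (val : ℝ → ℝ → ℝ) (c : ℚ)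
    (h : ∀ tp ∈ Set.Icc t₁ t₂, ∀ U ∈ Set.Icc U₁ U₂,
      ∀ (ω : InfVolFermionState 2) (Ls : ℕ → ℕ) (ψ : ∀ L, Fock (Orb (FermionTorus 2 L))),
      Tendsto Ls atTop atTop →
      (∀ j, IsGroundStateInSector (hubbardTorusTT' (Ls j) 1 tp U) (rectN n (Ls j)) 0 (ψ (Ls j))) →
      (∀ j, star (ψ (Ls j)) ⬝ᵥ ψ (Ls j) = 1) → ω.IsTorusLimitOf ψ Ls →
      val tp U ≤ (S.card : ℝ)⁻¹ * ∑ g ∈ S,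
        (ω.expect (d4ShiftSet g 0 (box 2 7)) (fermionEmbed (PolySite.d4Emb g 0 (box 2 7)) (-oddMomentObsTT tp U lam))).re)
    (hc : ∀ tp ∈ Set.Icc t₁ t₂, ∀ U ∈ Set.Icc U₁ U₂, -val tp U ≤ ((c : ℚ) : ℝ)) :
    ∀ tp ∈ Set.Icc t₁ t₂, ∀ U ∈ Set.Icc U₁ U₂, ObsStiffnessSeqCeilingAt tp U n c := by
  intro tp htp U hU
  exact ObsStiffnessSeqCeilingAt_on_tPrimeSegment_of_forall_orbitLower (U := U) (t₁ := tp) (t₂ := tp) lam hS hn0 hn2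
    (fun s => val s U) c (fun s hs => by
      have e : s = tp := le_antisymm hs.2 hs.1
      rw [e]
      exact h tp htp U hU)
    (fun s hs => by
      have e : s = tp := le_antisymm hs.2 hs.1
      rw [e]
      exact hc tp htp U hU) tp ⟨le_rfl, le_rfl⟩

/-- **Bilinear (four-corner) weights of a point of a rectangle.** For `t'₁ < t'₂`, `U₁ < U₂` and `(t', U)` in the rectangle, the
products of the one-dimensional barycentric weights are nonnegative, sum to `1`, and reproduce `t'` and `U` as the convex combination
of the four corners `(t'₁,U₁), (t'₁,U₂), (t'₂,U₁), (t'₂,U₂)` — the weights that feed four corner certificates into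
`…_convexCombObj_TT'_ineq_affine`. [folklore] -/
theorem tPrimeURect_weights {tp U : ℝ} (h12 : t₁ < t₂) (hU12 : U₁ < U₂) (ht1 : t₁ ≤ tp) (ht2 : tp ≤ t₂)
    (hU1 : U₁ ≤ U) (hU2 : U ≤ U₂) :
    let a := (t₂ - tp) / (t₂ - t₁)
    let b := (tp - t₁) / (t₂ - t₁)
    let p := (U₂ - U) / (U₂ - U₁)
    let q := (U - U₁) / (U₂ - U₁)
    (0 ≤ a * p ∧ 0 ≤ a * q ∧ 0 ≤ b * p ∧ 0 ≤ b * q) ∧ a * p + a * q + b * p + b * q = 1 ∧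
      (a * p) * t₁ + (a * q) * t₁ + (b * p) * t₂ + (b * q) * t₂ = tp ∧
      (a * p) * U₁ + (a * q) * U₂ + (b * p) * U₁ + (b * q) * U₂ = U := by
  obtain ⟨ha, hb, hab, htp, -⟩ := tPrimeSegment_weights h12 ht1 ht2
  obtain ⟨hp, hq, hpq, hUU, -⟩ := tPrimeSegment_weights hU12 hU1 hU2
  refine ⟨⟨mul_nonneg ha hp, mul_nonneg ha hq, mul_nonneg hb hp, mul_nonneg hb hq⟩, ?_, ?_, ?_⟩
  · calc _ = ((t₂ - tp) / (t₂ - t₁) + (tp - t₁) / (t₂ - t₁)) * ((U₂ - U) / (U₂ - U₁) + (U - U₁) / (U₂ - U₁)) := by ring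
      _ = 1 := by rw [hab, hpq, one_mul]
  · calc _ = ((t₂ - tp) / (t₂ - t₁) * t₁ + (tp - t₁) / (t₂ - t₁) * t₂) *
          ((U₂ - U) / (U₂ - U₁) + (U - U₁) / (U₂ - U₁)) := by ring
      _ = tp := by rw [htp, hpq, mul_one]
  · calc _ = ((t₂ - tp) / (t₂ - t₁) + (tp - t₁) / (t₂ - t₁)) *
          ((U₂ - U) / (U₂ - U₁) * U₁ + (U - U₁) / (U₂ - U₁) * U₂) := by ring
      _ = U := by rw [hab, hUU, one_mul]

/-- A convex combination of four constants is at least the smallest of them. [folklore] -/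
theorem min_le_convexComb_four {w₁ w₂ w₃ w₄ c₁ c₂ c₃ c₄ : ℝ} (h₁ : 0 ≤ w₁) (h₂ : 0 ≤ w₂) (h₃ : 0 ≤ w₃) (h₄ : 0 ≤ w₄)
    (hs : w₁ + w₂ + w₃ + w₄ = 1) :
    min (min c₁ c₂) (min c₃ c₄) ≤ w₁ * c₁ + w₂ * c₂ + w₃ * c₃ + w₄ * c₄ := by
  set m := min (min c₁ c₂) (min c₃ c₄) with hm
  have e1 : m ≤ c₁ := (min_le_left _ _).trans (min_le_left _ _)
  have e2 : m ≤ c₂ := (min_le_left _ _).trans (min_le_right _ _)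
  have e3 : m ≤ c₃ := (min_le_right _ _).trans (min_le_left _ _)
  have e4 : m ≤ c₄ := (min_le_right _ _).trans (min_le_right _ _)
  have key : m = w₁ * m + w₂ * m + w₃ * m + w₄ * m := by
    rw [← add_mul, ← add_mul, ← add_mul, hs, one_mul]
  rw [key]
  have := mul_le_mul_of_nonneg_left e1 h₁
  have := mul_le_mul_of_nonneg_left e2 h₂
  have := mul_le_mul_of_nonneg_left e3 h₃
  have := mul_le_mul_of_nonneg_left e4 h₄
  linarith

end Rectangle

end Summit.Ventures.CertifiedManyBodySolver.Observables

end
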